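import Literature.NumberTheory.GaloisRepresentations.BrauerTower
import HarnessLib

/-!
# `H²` with trivial (or `p`-primary) discrete coefficients: transport along `D ≃+ D₀` with the
# coefficient ring inert, `p`-power torsion of classes, and coprime-index descent

Topic `NumberTheory/GaloisRepresentations` (continuous cohomology of topological / profinite
groups); namespace `Literature.NumberTheory.GaloisRepresentations`.  Theorems only (no definition,
no named fact, no instance; D-0026).  Three pieces of bookkeeping on Mathlib's
`continuousCohomology` through the tree's continuous inhomogeneous `2`-cocycles
(`ContinuousH2.lean`: `twoCocycleClass_surjective`, `twoCocycleClass_eq_zero_iff`):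

* `subsingleton_H2_trivial_of_addEquiv` — **`H²(H, D₀) = 0 ⟹ H²(H, D) = 0` for `D ≃+ D₀`**
  discrete with the TRIVIAL action, over ANY coefficient rings `R₀` (for `D₀`) and `R` (for `D`):
  the cocycle and coboundary identities of a trivial representation do not see the scalars, so the
  vanishing is a statement about the topological group `H` and the abstract group `D` alone
  (this is why weak-Leopoldt-type statements "for every commutative topological ring `R` and every
  discrete `R`-module `D ≃ ℚ_p/ℤ_p` with the trivial action" reduce to one model, e.g. `R = ℤ`,
  `D = ℚ_p/ℤ_p`);
* `exists_pow_smul_twoCohomology_eq_zero` — over a COMPACT group, every class of `H²(G, X)` with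
  values in a discrete `p`-PRIMARY module is killed by a power of `p` (a continuous cocycle takes
  finitely many values);
* `subsingleton_H2_restrict_of_index_coprime` — **coprime-index descent**: for subgroups
  `A ≤ B` of a profinite group, `B` closed and `A` relatively open in `B` of index prime to `p`, and
  a discrete `p`-primary `G`-module, `H²(A, X) = 0 ⟹ H²(B, X) = 0` (`Res` is injective on `p`-primary classes,
  Serre I §3.3 Prop. 14 — the tree's `eq_zero_of_resH_eq_zero_of_psmul_eq_zero` — combined with
  the previous item and the comparison `resSub`/`resH` of `BrauerTower.lean`).

USE: the assembly of Iwasawa's theorem "weak Leopoldt holds for the cyclotomic `ℤ_p`-extension"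
(Neukirch–Schmidt–Wingberg (10.3.25)) in the open-subgroup presentation of
`Literature/NumberTheory/IwasawaTheory/WeakLeopoldtCyclotomic.lean`: model reduction, and the
passage from `Gal(K_S/K′(μ_{p^∞}))` to `Gal(K_S/K′K^{cyc}_∞)` (index dividing `p − 1`).
HONEST FRAMING: textbook bookkeeping; nothing arithmetic is proved here.

## References

* J.-P. Serre, *Cohomologie galoisienne* / *Galois Cohomology* (1997), I §2.2–2.3 (continuous
  cochains, classes of factor systems), I §3.3 Prop. 14 (`Res` injective on `p`-primary components
  for index prime to `p`). [SerreGaloisCohomology1997]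
* J. Neukirch, A. Schmidt, K. Wingberg, *Cohomology of Number Fields* (2008), (1.5.1), (10.3.25).
  [NeukirchSchmidtWingberg2008]
-/

noncomputable section

open CategoryTheory Topology

namespace Literature.NumberTheory.GaloisRepresentations

open _root_.TopRep _root_.ContRepresentation _root_.ContinuousCohomology

universe u

/-! ### §1. Transport of `H² = 0` for trivial coefficients along `D ≃+ D₀`, scalars inert -/

section Transport

variable {H : Type u} [Group H] [TopologicalSpace H] [IsTopologicalGroup H] [LocallyCompactSpace H]
variable {R₀ : Type*} [CommRing R₀] [TopologicalSpace R₀]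
variable {D₀ : Type u} [AddCommGroup D₀] [Module R₀ D₀] [TopologicalSpace D₀] [DiscreteTopology D₀]
  [ContinuousSMul R₀ D₀]
variable {R : Type*} [CommRing R] [TopologicalSpace R]
variable {D : Type u} [AddCommGroup D] [Module R D] [TopologicalSpace D] [DiscreteTopology D]
  [ContinuousSMul R D]

/-- **`H²(H, D₀) = 0 ⟹ H²(H, D) = 0` for discrete `D ≃+ D₀` with the trivial action, any
coefficient rings**: a continuous `D`-valued `2`-cocycle pushed through `e` is a `D₀`-valued
`2`-cocycle, hence a coboundary `δb₀`, and `e⁻¹ ∘ b₀` splits the original cocycle (the identities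
of a trivial representation involve only the additive structure).
[cite: SerreGaloisCohomology1997, I §2.3] [cite: NeukirchSchmidtWingberg2008, (1.5.1)] -/
theorem subsingleton_H2_trivial_of_addEquiv (e : D ≃+ D₀)
    (h : Subsingleton (continuousCohomology 2 (ContinuousRep.trivial H R₀ D₀).toTopRep)) :
    Subsingleton (continuousCohomology 2 (ContinuousRep.trivial H R D).toTopRep) := by
  refine subsingleton_of_forall_eq 0 fun x => ?_
  obtain ⟨c, rfl⟩ := twoCocycleClass_surjective _ x
  -- push the cocycle into `D₀`
  let c₀ : contTwoCocycles (ContinuousRep.trivial H R₀ D₀).toTopRep :=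
    ⟨⟨fun q => e (c.1 q), continuous_of_discreteTopology.comp c.1.continuous⟩, fun σ τ υ => by
      have hc := c.2 σ τ υ
      rw [ContinuousRep.toTopRep_ρ_apply, ContinuousRep.trivial_apply] at hc
      rw [ContinuousRep.toTopRep_ρ_apply, ContinuousRep.trivial_apply]
      change e (c.1 (τ, υ)) + e (c.1 (σ, τ * υ)) = e (c.1 (σ * τ, υ)) + e (c.1 (σ, τ))
      rw [← e.map_add, ← e.map_add, hc]⟩
  have h0 : twoCocycleClass _ c₀ = 0 := Subsingleton.elim _ _
  obtain ⟨b₀, hb₀⟩ := (twoCocycleClass_eq_zero_iff _ c₀).1 h0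
  -- pull the splitting cochain back to `D`
  refine (twoCocycleClass_eq_zero_iff _ c).2
    ⟨⟨fun σ => e.symm (b₀ σ), continuous_of_discreteTopology.comp b₀.continuous⟩, fun σ τ => ?_⟩
  have h3 := hb₀ σ τ
  rw [ContinuousRep.toTopRep_ρ_apply, ContinuousRep.trivial_apply] at h3
  rw [ContinuousRep.toTopRep_ρ_apply, ContinuousRep.trivial_apply]
  apply e.injective
  change c₀.1 (σ, τ) = _
  rw [h3]
  simp only [ContinuousMap.coe_mk, map_add, map_sub, AddEquiv.apply_symm_apply]

end Transport

/-! ### §2. Classes with `p`-primary discrete coefficients over a compact group are `p^r`-torsion -/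

section Torsion

variable {k : Type*} [CommRing k] [TopologicalSpace k]
variable {G : Type u} [Group G] [TopologicalSpace G] [IsTopologicalGroup G] [LocallyCompactSpace G]
  [CompactSpace G]
variable {M : Type u} [AddCommGroup M] [Module k M] [TopologicalSpace M] [DiscreteTopology M]
  [ContinuousSMul k M]

/-- **Every class of `H²(G, M)` is killed by a power of `p`** when `G` is compact and the discrete
coefficient module `M` is `p`-primary: the class of a continuous `2`-cocycle, whose finitely many
values are killed by a common power of `p`. [cite: SerreGaloisCohomology1997, I §2.2 Cor. 2] -/
theorem exists_pow_smul_twoCohomology_eq_zero (ρ : ContinuousRep G k M) {p : ℕ}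
    (hM : ∀ x : M, ∃ n : ℕ, p ^ n • x = 0) (z : continuousCohomology 2 ρ.toTopRep) :
    ∃ r : ℕ, p ^ r • z = 0 := by
  classical
  obtain ⟨f, rfl⟩ := twoCocycleClass_surjective ρ.toTopRep z
  let g : C(G × G, M) := f.1
  have hfin : (Set.range g).Finite := (isCompact_range g.continuous).finite_of_discrete
  choose n hn using hM
  -- a common exponent: the maximum of the exponents of the finitely many values
  refine ⟨hfin.toFinset.sup n, ?_⟩
  have hval : ∀ q, p ^ (hfin.toFinset.sup n) • g q = 0 := fun q => by
    have hle : n (g q) ≤ hfin.toFinset.sup n :=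
      Finset.le_sup (f := n) (hfin.mem_toFinset.mpr ⟨q, rfl⟩)
    obtain ⟨d, hd⟩ := Nat.exists_eq_add_of_le hle
    rw [hd, pow_add, mul_nsmul, hn, nsmul_zero]
  have hf : ((p ^ (hfin.toFinset.sup n) : ℕ) : k) • f = 0 := by
    refine Subtype.ext (ContinuousMap.ext fun q => ?_)
    change ((p ^ (hfin.toFinset.sup n) : ℕ) : k) • g q = 0
    rw [Nat.cast_smul_eq_nsmul]
    exact hval q
  rw [← Nat.cast_smul_eq_nsmul k, ← twoCocycleClass_smul, hf, twoCocycleClass_zero]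

end Torsion

/-! ### §3. Coprime-index descent of `H² = 0` for `p`-primary discrete coefficients -/

section Coprime

variable {G : Type u} [Group G] [TopologicalSpace G] [IsTopologicalGroup G] [CompactSpace G]
  [T2Space G] [TotallyDisconnectedSpace G]
variable {A₀ : Type u} [AddCommGroup A₀] [TopologicalSpace A₀] [DiscreteTopology A₀]
variable (ρ : ContinuousRep G ℤ A₀)

omit [CompactSpace G] [T2Space G] [TotallyDisconnectedSpace G] in
/-- Transport of `H²(T, X) = 0` along an equality `T = T'` of subgroups (the subgroup enters the
type). [folklore] -/
private theorem subsingleton_H2_restrict_congr {T T' : Subgroup G} (e : T = T')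
    (h : Subsingleton (continuousCohomology 2 (ρ.restrict (subgroupIncl T)).toTopRep)) :
    Subsingleton (continuousCohomology 2 (ρ.restrict (subgroupIncl T')).toTopRep) := by
  subst e
  exact h

/-- **Coprime-index descent**: let `A ≤ B` be subgroups of a profinite group `G`, `B` closed and
`A` (relatively) open in `B` of index prime to `p`, and `X` a discrete `p`-primary `G`-module.  If
`H²(A, X) = 0` then `H²(B, X) = 0`: a class of `H²(B, X)` is `p^r`-torsion
(`exists_pow_smul_twoCohomology_eq_zero`) and restricts to `0` on `A`, so it vanishes, `Res` being
injective on `p`-primary classes for an open subgroup of index prime to `p`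
(`eq_zero_of_resH_eq_zero_of_psmul_eq_zero`). [cite: SerreGaloisCohomology1997, I §3.3 Prop. 14 and Cor. 1] -/
theorem subsingleton_H2_restrict_of_index_coprime {p : ℕ} (hX : ∀ x : A₀, ∃ k : ℕ, p ^ k • x = 0)
    {A B : Subgroup G} (hAB : A ≤ B) (hB : IsClosed (B : Set G))
    (hopen : IsOpen ((A.subgroupOf B : Subgroup B) : Set B))
    (hcop : (A.subgroupOf B).index.Coprime p)
    (h : Subsingleton (continuousCohomology 2 (ρ.restrict (subgroupIncl A)).toTopRep)) :
    Subsingleton (continuousCohomology 2 (ρ.restrict (subgroupIncl B)).toTopRep) := by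
  haveI : IsClosed (B : Set G) := hB
  haveI : CompactSpace B := isCompact_iff_compactSpace.mp hB.isCompact
  refine subsingleton_of_forall_eq 0 fun z => ?_
  -- `A` as the image of `A.subgroupOf B`
  have hmap : (A.subgroupOf B).map B.subtype = A := by
    rw [Subgroup.subgroupOf_map_subtype, inf_eq_left.mpr hAB]
  have hres : resSub ρ (map_subtype_le' (A.subgroupOf B)) 2 z = 0 := by
    haveI := subsingleton_H2_restrict_congr ρ hmap.symm h
    exact Subsingleton.elim _ _
  have hz : resH (A.subgroupOf B) (ρ.restrict (subgroupIncl B)) 2 z = 0 :=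
    (resSub_eq_zero_iff_resH_eq_zero ρ (A.subgroupOf B) 2 z).1 hres
  obtain ⟨r, hr⟩ := exists_pow_smul_twoCohomology_eq_zero (ρ.restrict (subgroupIncl B))
    (p := p) hX z
  exact eq_zero_of_resH_eq_zero_of_psmul_eq_zero (ρ.restrict (subgroupIncl B)) (A.subgroupOf B)
    hopen hcop z hz hr

end Coprime

end Literature.NumberTheory.GaloisRepresentations

end
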